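import Literature.AlgebraicGeometry.AbelianSchemes.IsogenyOfGenericIsogeny
import Literature.AlgebraicGeometry.AbelianSchemes.AbelianSchemeFibreBaseChangeHom
import Literature.AlgebraicGeometry.Limits.SliceBaseChange
import Literature.NumberTheory.GaloisRepresentations.ClosureValuationSubring
import Mathlib.RingTheory.DedekindDomain.IntegralClosure
import Mathlib.FieldTheory.IntermediateField.Basic
import HarnessLib

/-!
# Néron extension over an OVER-RING of a Dedekind stage: a homomorphism of generic fibres that DESCENDS to the stage
# extends over any `R ⊇ D`, uniquely, and a generic isogeny stays an isogeny on every fibre after base change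
# ([BoschLutkebohmertRaynaud1990] §1.2 Prop. 8, §7.3 Prop. 6; [Artin1986NeronModels] (1.1), Cor. (1.4); [GortzWedhorn2020] (4.7))

Topic `Literature/AlgebraicGeometry/AbelianSchemes`, namespace `Literature.AlgebraicGeometry.AbelianSchemes.AbelianSchemeOver`.
THEOREMS ONLY (no definition, no named fact, no instance, no notation, no `sorry`).  Cell `hodgecm-mathlib` (D-0151), programme
F0∕P6 «MOD», organ **(ν3)** of the G1c «ROOF REDUCTION» remainder (A-p17 (g26) FINDING 2026-09-01 «G1c BASE IS NOT DEDEKIND»;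
(ν1) ★ `Motives/ValuationRingPointFiniteStage`, (ν2) A-p14 «homs over `Ω̄` descend to a finite stage»).

THE POINT.  The ★ Néron mapping property (`AbelianSchemeOverGenericFibreExtension`: `existsUnique_hom_map_genericFibre_eq′`,
`isMonHom_of_isMonHom_genericFibre`) and ★ `IsogenyOfGenericIsogeny` bind `[IsDedekindDomain D]`; the base of record of the P6
reduction step is `R = 𝒪_{Ω̄}` (★ `closureValuationSubring`), a NON-noetherian valuation ring receiving a Dedekind stage
`h : D → R` (by (ν1)).  This file moves the two ★ theorems from `D` to `R`:

* §1 **`exists_hom_map_genericFibre_eq_of_descends`** — `D` Dedekind with fraction field `L`, `R` any ring with a field of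
  fractions `Ω` (`IsFractionRing R Ω`), `h : D → R`, `j : L → Ω` over a common composite `a : Spec Ω → Spec D`
  (`Spec Ω → Spec R → Spec D = a = Spec Ω → Spec L → Spec D`), `A, B` abelian schemes over `Spec D` with base changes
  `A_R, B_R` along `Spec h`.  If a morphism `u : (A_R)_Ω → (B_R)_Ω` of the generic fibres over `Ω` DESCENDS to a morphism
  `u_L : A_L → B_L` of the generic fibres over `L` — `u` and `u_L ⊗_L Ω` agree under the transitivity isomorphisms
  `(A_R)_Ω ≅ A_a ≅ (A_L)_Ω` (★ `Limits.pullbackFacObjIso`, explicit projections) — then `u` EXTENDS to an `R`-morphism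
  `U : A_R → B_R` with `U_Ω = u`, UNIQUELY (★ `map_genericFibre_injective`: `A_R` flat, `B_R` separated — no hypothesis on `R`),
  and `U` is a homomorphism when `u_L` is.  Proof: ★ Néron over `D` extends `u_L` to `U_D : A → B`; `U := U_D ×_D R`; the two
  naturality squares of `pullbackFacObjIso` and the descent hypothesis give `U_Ω = u`.
* §2 **`isIsogeny_fibreHom_baseChangeHom_of_isIsogeny_genericFibre`** — if `U_D : A → B` is a homomorphism over the Dedekind `D`
  whose generic fibre is an isogeny, then for EVERY base change `g : S′ → Spec D` and every field point `t` of `S′` the fibre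
  `(U_D ×_D S′)_t` is an isogeny (★ `isIsogeny_fibreHom_of_isIsogeny_genericFibre` at `t ≫ g`, transported along ★
  `fibreBaseChangeIso`); `isIsogeny_hom_comp_iso` is the transport lemma (an isogeny conjugated by isomorphisms is an isogeny).
* §3 `exists_hom_isIsogeny_fibreHom_of_descends` — §1 + §2 together: the extension `U` over `R` of a descending `u` whose
  stage `u_L` is an isogeny is an isogeny on every fibre of `A_R → Spec R` (in particular on the special fibre).
* §4 `specGenericPoint_comp_specMap_eq_of_coe_eq` — THE CASE OF RECORD docks: for `R = closureValuationSubring F` (`F` a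
  nonarchimedean local field, `Ω = F̄`), a finite stage `F ⊆ L ⊆ F̄`, `D = integralClosure 𝒪[F] L` and the inclusion `h : D → R`
  of ★ (ν1) `exists_ringHom_integralClosure_closureValuationSubring` (`h x = x` in `F̄`), the two composites `Spec F̄ → Spec L → Spec D`
  and `Spec F̄ → Spec R → Spec D` AGREE — the hypothesis `ha₂` of §1∕§3 with `a := Spec F̄ → Spec R → Spec D`, `ha₁ := rfl`.

Consumers (G1c, σ1∕σ2 pens): with (ν1) `univ_{x̃} = univ_z ×_{R_L} R` and (ν2) `q = q_{L′} ⊗ Ω`, this yields `q_R : 𝒜₁ → ℬ` over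
`R = 𝒪_{Ω̄}` and the downstairs isogeny `q̄ = (q_R)_s`.  HONEST LABEL: HC_CM is proved only modulo the cell's 2 remaining named
inputs (hLiu418 24832, h413 24833) until rung 0 closes; generic capital on `--supports stmt-HodgeConjecture-24832`, pays no letter.

## References
* [BoschLutkebohmertRaynaud1990] S. Bosch, W. Lütkebohmert, M. Raynaud, *Néron Models* (1990), §1.2 Prop. 8 (abelian schemes are
  Néron models), §1.2 Prop. 2 (c) (Néron models and base change along extensions of ramification index 1 — here only the trivial
  direction «extend over `D`, then base-change» is used), §7.3 Prop. 6.
* [Artin1986NeronModels] M. Artin, *Néron models*, in: Arithmetic Geometry (Cornell–Silverman, 1986), §1 (1.1), Cor. (1.4).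
* [GortzWedhorn2020] U. Görtz, T. Wedhorn, *Algebraic Geometry I*, 2nd ed., Section (4.7), Prop. 4.16 (transitivity of base change).
* [MumfordFogartyKirwan1994] D. Mumford, J. Fogarty, F. Kirwan, *GIT*, 3rd ed., Ch. 6 §1 Cor. 6.4, Ch. 7 §2 Def. 7.2.
* [MumfordAV1970] D. Mumford, *Abelian Varieties* (1970), §7 Application 3 p. 63 (isogenies: surjective homomorphisms with finite kernel).
-/

set_option autoImplicit false

noncomputable section

set_option backward.isDefEq.respectTransparency false

universe u

open CategoryTheory CategoryTheory.Limits AlgebraicGeometry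
open scoped MonObj CategoryTheory.Obj
open Literature.NumberTheory.EllipticCurves (genericFibre specGenericPoint map_genericFibre_injective)
open Literature.AlgebraicGeometry.Motives (AbelianVariety)
open Literature.AlgebraicGeometry.Limits (pullbackFacObjIso pullbackFacObjIso_naturality)

namespace Literature.AlgebraicGeometry.AbelianSchemes

namespace AbelianSchemeOver

/-! ## §1 Extension over an over-ring of a morphism of generic fibres that descends to the Dedekind stage -/

section Extend

variable {D : Type u} [CommRing D] [IsDedekindDomain D] (L : Type u) [Field L] [Algebra D L] [IsFractionRing D L]
  {R : Type u} [CommRing R] (Ω : Type u) [Field Ω] [Algebra R Ω] [IsFractionRing R Ω]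
  (h : D →+* R) (j : L →+* Ω) (a : Spec (.of Ω) ⟶ Spec (.of D))
  (ha₁ : specGenericPoint R Ω ≫ Spec.map (CommRingCat.ofHom h) = a)
  (ha₂ : Spec.map (CommRingCat.ofHom j) ≫ specGenericPoint D L = a)
  (A B : AbelianSchemeOver (Spec (.of D)))

/-- **Néron extension over an over-ring of a Dedekind stage.**  `D` Dedekind with fraction field `L`, `R` a ring with field of
fractions `Ω`, `h : D → R` and `j : L → Ω` over a common composite `a : Spec Ω → Spec D` (`ha₁`, `ha₂`), `A, B` abelian schemes over
`Spec D`, `A_R := A ×_D R`, `B_R`.  Let `u : (A_R)_Ω → (B_R)_Ω` be an `Ω`-morphism of the generic fibres which DESCENDS to an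
`L`-morphism `u_L : A_L → B_L` of the generic fibres over the stage: `u ≫ ((B_R)_Ω ≅ B_a ≅ (B_L)_Ω) = ((A_R)_Ω ≅ A_a ≅ (A_L)_Ω) ≫ (u_L ⊗_L Ω)`
for the transitivity isomorphisms ★ `pullbackFacObjIso`.  Then there is an `R`-morphism `U : A_R → B_R` with generic fibre `u`,
it is a homomorphism of `R`-group schemes if `u_L` is one of `L`-group schemes, and it is the ONLY `R`-morphism with generic fibre
`u`.  Proof: the Néron mapping property of `B` over the Dedekind `D` (★ `existsUnique_hom_map_genericFibre_eq′`,
[BoschLutkebohmertRaynaud1990] Prop. 1.2∕8) extends `u_L` to `U_D : A → B`; `U := U_D ×_D R`; naturality of the transitivity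
isomorphisms in `A ↦ A_a`; uniqueness over ANY `R` by schematic density of the generic fibre of the flat `A_R` in front of the
separated `B_R` (★ `map_genericFibre_injective`, [Artin1986NeronModels] (1.1)).
[cite: BoschLutkebohmertRaynaud1990, §1.2 Prop. 8] [cite: Artin1986NeronModels, §1 (1.1) (p. 214) and Cor. (1.4) (p. 215)]
[cite: GortzWedhorn2020, Section (4.7), Prop. 4.16] -/
theorem exists_hom_map_genericFibre_eq_of_descends
    (uL : (genericFibre D L).obj A.X ⟶ (genericFibre D L).obj B.X)
    (u : (genericFibre R Ω).obj (A.baseChange (Spec.map (CommRingCat.ofHom h))).X ⟶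
      (genericFibre R Ω).obj (B.baseChange (Spec.map (CommRingCat.ofHom h))).X)
    (hu : u ≫ (pullbackFacObjIso (Spec.map (CommRingCat.ofHom h)) (specGenericPoint R Ω) a ha₁ B.X).hom ≫
        (pullbackFacObjIso (specGenericPoint D L) (Spec.map (CommRingCat.ofHom j)) a ha₂ B.X).inv =
      ((pullbackFacObjIso (Spec.map (CommRingCat.ofHom h)) (specGenericPoint R Ω) a ha₁ A.X).hom ≫
        (pullbackFacObjIso (specGenericPoint D L) (Spec.map (CommRingCat.ofHom j)) a ha₂ A.X).inv) ≫
        (Over.pullback (Spec.map (CommRingCat.ofHom j))).map uL) :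
    ∃ U : (A.baseChange (Spec.map (CommRingCat.ofHom h))).X ⟶ (B.baseChange (Spec.map (CommRingCat.ofHom h))).X,
      (genericFibre R Ω).map U = u ∧
      (IsMonHom uL → IsMonHom U) ∧
      (∃ UD : A.X ⟶ B.X, (genericFibre D L).map UD = uL ∧ U = baseChangeHom UD (Spec.map (CommRingCat.ofHom h))) ∧
      ∀ U' : (A.baseChange (Spec.map (CommRingCat.ofHom h))).X ⟶ (B.baseChange (Spec.map (CommRingCat.ofHom h))).X,
        (genericFibre R Ω).map U' = u → U' = U := by
  -- Néron over the Dedekind stage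
  obtain ⟨UD, hUD, -⟩ := A.existsUnique_hom_map_genericFibre_eq' L B uL
  -- the two naturality squares of the transitivity isomorphisms
  have n₁ := pullbackFacObjIso_naturality (Spec.map (CommRingCat.ofHom h)) (specGenericPoint R Ω) a ha₁ UD
  have n₂ := pullbackFacObjIso_naturality (specGenericPoint D L) (Spec.map (CommRingCat.ofHom j)) a ha₂ UD
  have hUD' : (Over.pullback (specGenericPoint D L)).map UD = uL := hUD
  rw [hUD'] at n₂
  have n₂' : (Over.pullback a).map UD =
      (pullbackFacObjIso (specGenericPoint D L) (Spec.map (CommRingCat.ofHom j)) a ha₂ A.X).inv ≫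
        (Over.pullback (Spec.map (CommRingCat.ofHom j))).map uL ≫
          (pullbackFacObjIso (specGenericPoint D L) (Spec.map (CommRingCat.ofHom j)) a ha₂ B.X).hom := by
    rw [Iso.eq_inv_comp, ← n₂]
  have key : (genericFibre R Ω).map (baseChangeHom UD (Spec.map (CommRingCat.ofHom h))) = u := by
    change (Over.pullback (specGenericPoint R Ω)).map ((Over.pullback (Spec.map (CommRingCat.ofHom h))).map UD) = u
    have hX : (Over.pullback (specGenericPoint R Ω)).map ((Over.pullback (Spec.map (CommRingCat.ofHom h))).map UD) ≫
        (pullbackFacObjIso (Spec.map (CommRingCat.ofHom h)) (specGenericPoint R Ω) a ha₁ B.X).hom ≫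
          (pullbackFacObjIso (specGenericPoint D L) (Spec.map (CommRingCat.ofHom j)) a ha₂ B.X).inv =
        ((pullbackFacObjIso (Spec.map (CommRingCat.ofHom h)) (specGenericPoint R Ω) a ha₁ A.X).hom ≫
          (pullbackFacObjIso (specGenericPoint D L) (Spec.map (CommRingCat.ofHom j)) a ha₂ A.X).inv) ≫
          (Over.pullback (Spec.map (CommRingCat.ofHom j))).map uL := by
      rw [← Category.assoc, n₁, Category.assoc, n₂']
      simp only [Category.assoc, Iso.hom_inv_id, Category.comp_id]
    rw [← hu] at hX
    have hX' := congrArg (fun φ => φ ≫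
      (pullbackFacObjIso (specGenericPoint D L) (Spec.map (CommRingCat.ofHom j)) a ha₂ B.X).hom ≫
        (pullbackFacObjIso (Spec.map (CommRingCat.ofHom h)) (specGenericPoint R Ω) a ha₁ B.X).inv) hX
    simpa only [Category.assoc, Iso.inv_hom_id_assoc, Iso.hom_inv_id, Category.comp_id] using hX'
  refine ⟨baseChangeHom UD (Spec.map (CommRingCat.ofHom h)), key, fun hmono => ?_, ⟨UD, hUD, rfl⟩, fun U' hU' => ?_⟩
  · haveI : IsMonHom ((genericFibre D L).map UD) := by rw [hUD]; exact hmono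
    haveI : IsMonHom UD := A.isMonHom_of_isMonHom_genericFibre L B UD
    exact isMonHom_baseChangeHom UD _
  · haveI := (B.baseChange (Spec.map (CommRingCat.ofHom h))).isProper
    haveI := (A.baseChange (Spec.map (CommRingCat.ofHom h))).isSmooth
    haveI : Flat (A.baseChange (Spec.map (CommRingCat.ofHom h))).X.hom := inferInstance
    exact map_genericFibre_injective R Ω (B.baseChange (Spec.map (CommRingCat.ofHom h))).X
      (A.baseChange (Spec.map (CommRingCat.ofHom h))).X (hU'.trans key.symm)

end Extend

/-! ## §2 A generic isogeny over a Dedekind stage is an isogeny on every fibre of every base change -/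

section Fibres

/-- Transport lemma: a morphism of abelian varieties conjugate to an isogeny by isomorphisms is an isogeny
(surjectivity and finiteness of the underlying scheme morphism are stable under composition with isomorphisms).
[cite: MumfordAV1970, §7 Application 3 (p. 63)] -/
theorem isIsogeny_hom_comp_iso {k : Type u} [Field k] {X X' Y Y' : AbelianVariety k} (eX : X' ≅ X) (f : X ⟶ Y) (eY : Y ≅ Y')
    (hf : AbelianVariety.IsIsogeny f) : AbelianVariety.IsIsogeny (eX.hom ≫ f ≫ eY.hom) := by
  have hiso : ∀ {P Q : AbelianVariety k} (e : P ≅ Q), AbelianVariety.IsIsogeny e.hom := by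
    intro P Q e
    haveI : IsIso (AbelianVariety.Hom.toSchemeHom e.hom) :=
      ⟨AbelianVariety.Hom.toSchemeHom e.inv,
        by
          change AbelianVariety.Hom.toSchemeHom (e.hom ≫ e.inv) = _
          rw [e.hom_inv_id]; rfl,
        by
          change AbelianVariety.Hom.toSchemeHom (e.inv ≫ e.hom) = _
          rw [e.inv_hom_id]; rfl⟩
    exact ⟨inferInstance, inferInstance⟩
  exact AbelianVariety.isIsogeny_comp (hiso eX) (AbelianVariety.isIsogeny_comp hf (hiso eY))

variable {D : Type u} [CommRing D] [IsDedekindDomain D] (L : Type u) [Field L] [Algebra D L] [IsFractionRing D L]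
  {A B : AbelianSchemeOver (Spec (.of D))} (UD : A.X ⟶ B.X) [IsMonHom UD]

/-- **A generic isogeny over a Dedekind stage is an isogeny on EVERY fibre of EVERY base change.**  `D` Dedekind with fraction
field `L`, `U_D : A → B` a homomorphism of abelian schemes over `Spec D` whose generic fibre `(U_D)_L` is an isogeny; then for every
`g : S′ → Spec D` (e.g. `Spec 𝒪_{Ω̄} → Spec D`) and every field-valued point `t : Spec k → S′` the fibre `(U_D ×_D S′)_t` is an
isogeny: it is conjugate (★ `fibreHom_baseChangeHom_comp_fibreBaseChangeIso_hom`, transitivity of base change) to the fibre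
`(U_D)_{t ≫ g}`, an isogeny by [BoschLutkebohmertRaynaud1990] §7.3 Prop. 6 (★ `isIsogeny_fibreHom_of_isIsogeny_genericFibre`).
[cite: BoschLutkebohmertRaynaud1990, §7.3 Prop. 6 (p. 180)] [cite: GortzWedhorn2020, Section (4.7) (p. 135)]
[cite: MumfordFogartyKirwan1994, Ch. 7 §2 Definition 7.2 (p. 129)] -/
theorem isIsogeny_fibreHom_baseChangeHom_of_isIsogeny_genericFibre
    (hUD : AbelianVariety.IsIsogeny (fibreHom UD (specGenericPoint D L)))
    {S' : Scheme.{u}} (g : S' ⟶ Spec (.of D)) {k : Type u} [Field k] (t : Spec (.of k) ⟶ S') :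
    haveI := isMonHom_baseChangeHom UD g
    AbelianVariety.IsIsogeny (fibreHom (baseChangeHom UD g) t) := by
  haveI := isMonHom_baseChangeHom UD g
  have h1 : AbelianVariety.IsIsogeny (fibreHom UD (t ≫ g)) := isIsogeny_fibreHom_of_isIsogeny_genericFibre L UD hUD (t ≫ g)
  have h3 := fibreHom_baseChangeHom_comp_fibreBaseChangeIso_hom g t UD
  have h2 : fibreHom (baseChangeHom UD g) t =
      ((A.fibreBaseChangeIso g t).hom ≫ fibreHom UD (t ≫ g)) ≫ (B.fibreBaseChangeIso g t).inv :=
    (Iso.eq_comp_inv _).mpr h3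
  rw [h2, Category.assoc]
  exact isIsogeny_hom_comp_iso (A.fibreBaseChangeIso g t) (fibreHom UD (t ≫ g)) (B.fibreBaseChangeIso g t).symm h1

end Fibres

/-! ## §3 Together: the extension over `R` of a descending generic isogeny is an isogeny on every fibre -/

section Together

variable {D : Type u} [CommRing D] [IsDedekindDomain D] (L : Type u) [Field L] [Algebra D L] [IsFractionRing D L]
  {R : Type u} [CommRing R] (Ω : Type u) [Field Ω] [Algebra R Ω] [IsFractionRing R Ω]
  (h : D →+* R) (j : L →+* Ω) (a : Spec (.of Ω) ⟶ Spec (.of D))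
  (ha₁ : specGenericPoint R Ω ≫ Spec.map (CommRingCat.ofHom h) = a)
  (ha₂ : Spec.map (CommRingCat.ofHom j) ≫ specGenericPoint D L = a)
  (A B : AbelianSchemeOver (Spec (.of D)))

/-- **Extension over `R` of a descending generic ISOGENY.**  In the situation of `exists_hom_map_genericFibre_eq_of_descends`, if the
stage morphism `u_L : A_L → B_L` is a homomorphism of `L`-group schemes whose underlying morphism of schemes is SURJECTIVE and
FINITE (i.e. `u_L` is an isogeny of abelian varieties over `L`), then the extension `U : A_R → B_R` of `u` is a homomorphism whose
fibre at EVERY field-valued point of `Spec R` — the generic point and the special points alike — is an isogeny.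
[cite: BoschLutkebohmertRaynaud1990, §1.2 Prop. 8 and §7.3 Prop. 6 (p. 180)] [cite: Artin1986NeronModels, Cor. (1.4) (p. 215)] -/
theorem exists_hom_isIsogeny_fibreHom_of_descends
    (uL : (genericFibre D L).obj A.X ⟶ (genericFibre D L).obj B.X) [IsMonHom uL]
    (huLs : Surjective uL.left) (huLf : IsFinite uL.left)
    (u : (genericFibre R Ω).obj (A.baseChange (Spec.map (CommRingCat.ofHom h))).X ⟶
      (genericFibre R Ω).obj (B.baseChange (Spec.map (CommRingCat.ofHom h))).X)
    (hu : u ≫ (pullbackFacObjIso (Spec.map (CommRingCat.ofHom h)) (specGenericPoint R Ω) a ha₁ B.X).hom ≫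
        (pullbackFacObjIso (specGenericPoint D L) (Spec.map (CommRingCat.ofHom j)) a ha₂ B.X).inv =
      ((pullbackFacObjIso (Spec.map (CommRingCat.ofHom h)) (specGenericPoint R Ω) a ha₁ A.X).hom ≫
        (pullbackFacObjIso (specGenericPoint D L) (Spec.map (CommRingCat.ofHom j)) a ha₂ A.X).inv) ≫
        (Over.pullback (Spec.map (CommRingCat.ofHom j))).map uL) :
    ∃ (U : (A.baseChange (Spec.map (CommRingCat.ofHom h))).X ⟶ (B.baseChange (Spec.map (CommRingCat.ofHom h))).X)
      (_ : IsMonHom U),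
      (genericFibre R Ω).map U = u ∧
      (∀ U' : (A.baseChange (Spec.map (CommRingCat.ofHom h))).X ⟶ (B.baseChange (Spec.map (CommRingCat.ofHom h))).X,
        (genericFibre R Ω).map U' = u → U' = U) ∧
      ∀ {k : Type u} [Field k] (t : Spec (.of k) ⟶ Spec (.of R)), AbelianVariety.IsIsogeny (fibreHom U t) := by
  obtain ⟨U, hUu, hmono, ⟨UD, hUD, rfl⟩, huniq⟩ :=
    exists_hom_map_genericFibre_eq_of_descends L Ω h j a ha₁ ha₂ A B uL u hu
  haveI : IsMonHom ((genericFibre D L).map UD) := by rw [hUD]; infer_instance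
  haveI : IsMonHom UD := A.isMonHom_of_isMonHom_genericFibre L B UD
  -- the generic fibre of `U_D` is the isogeny `u_L`
  have hiso : AbelianVariety.IsIsogeny (fibreHom UD (specGenericPoint D L)) := by
    have hleft : AbelianVariety.Hom.toSchemeHom (fibreHom UD (specGenericPoint D L)) = uL.left := by
      change ((fibreHom UD (specGenericPoint D L)).hom.hom.hom).left = uL.left
      rw [fibreHom_hom_hom_hom]
      exact congrArg CommaMorphism.left hUD
    constructor
    · rw [hleft]; exact huLs
    · rw [hleft]; exact huLf
  refine ⟨baseChangeHom UD (Spec.map (CommRingCat.ofHom h)), isMonHom_baseChangeHom UD _, hUu, huniq, fun t => ?_⟩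
  exact isIsogeny_fibreHom_baseChangeHom_of_isIsogeny_genericFibre L UD hiso (Spec.map (CommRingCat.ofHom h)) t

end Together

/-! ## §4 The case of record: `R = 𝒪_{F̄}`, `D = integralClosure 𝒪[F] L` for a finite stage `L` -/

section Record

open ValuativeRel Literature.NumberTheory.GaloisRepresentations

variable {F : Type u} [Field F] [ValuativeRel F] [TopologicalSpace F] [IsNonarchimedeanLocalField F]

/-- **Docking with ★ (ν1) `ValuationRingPointFiniteStage`.**  For a nonarchimedean local field `F`, an intermediate field
`F ⊆ L ⊆ F̄`, the stage `D := integralClosure 𝒪[F] L` and a ring map `h : D → R := closureValuationSubring F` with `h x = x` in `F̄`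
(★ `exists_ringHom_integralClosure_closureValuationSubring`), the square of generic points commutes:
`(Spec F̄ → Spec L) ≫ (Spec L → Spec D) = (Spec F̄ → Spec R) ≫ Spec h` — i.e. hypothesis `ha₂` of
`exists_hom_map_genericFibre_eq_of_descends` ∕ `exists_hom_isIsogeny_fibreHom_of_descends` holds with `j := (L → F̄)`,
`a := (Spec F̄ → Spec R) ≫ Spec h` and `ha₁ := rfl`. [cite: NeukirchANT1999, Ch. II (4.8)] [cite: GortzWedhorn2020, Section (4.7)] -/
theorem specGenericPoint_comp_specMap_eq_of_coe_eq (L : IntermediateField F (AlgebraicClosure F))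
    (h : integralClosure 𝒪[F] L →+* closureValuationSubring F)
    (hh : ∀ x, ((h x : closureValuationSubring F) : AlgebraicClosure F) = ((x : L) : AlgebraicClosure F)) :
    Spec.map (CommRingCat.ofHom (algebraMap L (AlgebraicClosure F))) ≫ specGenericPoint (integralClosure 𝒪[F] L) L =
      specGenericPoint (closureValuationSubring F) (AlgebraicClosure F) ≫ Spec.map (CommRingCat.ofHom h) := by
  change Spec.map _ ≫ Spec.map _ = Spec.map _ ≫ Spec.map _
  rw [← Spec.map_comp, ← Spec.map_comp, ← CommRingCat.ofHom_comp, ← CommRingCat.ofHom_comp]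
  congr 2
  ext x
  exact (hh x).symm

end Record

end AbelianSchemeOver

end Literature.AlgebraicGeometry.AbelianSchemes

end
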